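import Literature.MathematicalPhysics.QuantumFieldTheory.Balaban1983to89.B4Block227
import HarnessLib

/-!
# DAG node N07 [B11], the (P)_D located-research thread (road R0′ junction `hker` at the record; INERT under road (a)):
# PINNED-LINE INEQUALITIES — the second-order (plate) Poincaré inequalities on a lattice segment pinned at BOTH ends,
# `ℕ`-indexed, with explicit `ℓ`-uniform constants, on top of the tree's first-order path Poincaré toolkit BY NAME

Cell `pub-ymgap` (HUMAN RULINGS D-0062 ∕ D-0149 ∕ D-0154), width seat `pub-ymgap-dag-n07-w7` g7, CLAIM-1 (cell bus
2026-08-28T15:16Z).  `--kind proof --supports stmt-QuantumFields-27364 --as helper` (K1⁹ per dag-lead KEY MAP v2; count-neutral).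
THEOREMS ONLY (no `def`, no `instance`, no `notation`).

WHY.  Every x-space layer estimate on the (P)_D roads (dag-n07-w5 LOCATED-PD-LOCALIZATION-ROAD; this lineage's
LOCATED-KPOS-MULTILEVEL §4 and ROAD-L4-V3) controls a lattice function `μ` and its differences on a tile LINE between two
PINNED CENTRES `c`, `c + ℓe_κ` (`μ(c) = μ(c + ℓe_κ) = 0`) by the second differences along that line — the plate
scaling `Σ μ² ≲ ℓ⁴ Σ (∂∂μ)²`, `Σ (∂μ)² ≲ ℓ² Σ (∂∂μ)²`.  The tree has the FIRST-order toolkit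
(`Beta.BlockPoincare.poincare_path`, `B4Block227.poincare_path8` = mean-zero Poincaré with the constant `s²∕8`,
`B4Block227.sq_sub_le_Ico`, `B4Block227.sum_range_id_real`); this file adds the pinned second-order statements,
`ℕ`-indexed (the shape the `TorusSite` line arguments consume: offsets `c + t•e_κ`, `t : ℕ`).
* §1 `sum_sq_le_of_sum_eq_zero_nat` — `Σ_{i≤m} w i = 0 ⇒ Σ_{i≤m} (w i)² ≤ ((m+1)²∕8)·Σ_{i<m} (w(i+1) − w i)²`
  (`poincare_path8` BY NAME, transported to `ℕ`-indexed sequences).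
* §2 ★ `sum_fd_sq_le_of_pinned` — `v 0 = v n = 0 ⇒ Σ_{i<n} (v(i+1) − v i)² ≤ (n²∕8)·Σ_{i<n−1} (v(i+2) − 2v(i+1) + v i)²`
  (the forward differences of a doubly pinned sequence have zero sum);
  `sum_sq_le_of_pinned_left` — `v 0 = 0 ⇒ Σ_{k≤n} (v k)² ≤ (n(n+1)∕2)·Σ_{i<n} (v(i+1) − v i)²` (`sq_sub_le_Ico` summed);
  ★★ `sum_sq_le_sum_sdd_sq_of_pinned` — `v 0 = v n = 0 ⇒ Σ_{k≤n} (v k)² ≤ (n³(n+1)∕16)·Σ_{i<n−1} (v(i+2) − 2v(i+1) + v i)²`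
  (the pinned PLATE inequality; the sharp constant is `(2 sin(π∕2n))⁻⁴ ≈ n⁴∕97`, not needed).
* §3 translated editions on a segment `[a, a+n]` of a longer line (`v a = v (a+n) = 0`, sums over `Finset.Ico`):
  `sum_fd_sq_Ico_le_of_pinned`, ★★ `sum_sq_Ico_le_of_pinned`; and the scale reading `n³(n+1)∕16 ≤ n⁴∕8`.

HONEST FRAMING (binding).  Count-neutral helper; [folklore] real analysis on finite sums (telescoping + Cauchy–Schwarz, no
spectral theory); asserts NOTHING of [B11]∕[B6]∕[B5]∕[3].  These 1-D constants are `ℓ`-UNIFORM in the plate scaling; the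
`d`-dimensional «pinned on the centre lattice» assembly is deliberately NOT typed: it is `ℓ`-uniform only for `d ≤ 3`
(in `d = 4` point constraints are `H²`-critical and the assembled constant grows like `log ℓ` — ROAD-L4-V3 (D), located,
not typed).  `(P)_D` for Bałaban's `d = 4` nested geometries stays OPEN; under road (a) of the K0 lineage nothing here is
consumed; `hker` at the record ∕ stub 1 ∕ K0⁷ ∕ K1⁹ NOT closed; N07 NOT discharged; counts unmoved; no summit statement is
proved by this seat — R4 closes the conditional finite-𝕋⁴ rung `BalabanLadder.UV` only; nothing continuum ∕ ℝ⁴ ∕ OS ∕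
mass gap ∕ Clay.  Context only (no hypothesis is a citation): T. Bałaban, CMP **109** (1987) 249–301 [Balaban1987RG1] (0.4)
(averaging at block centres, odd `L`); CMP **96** (1984) 223–250 [Balaban1984PropagatorsII] (2.22).
-/

set_option autoImplicit false

noncomputable section

open Finset

namespace Summit.QuantumFields.YangMills.Theorems.N07PinnedLineInequalities

open Literature.MathematicalPhysics.QuantumFieldTheory.Balaban1983to89
open Beta.BlockPoincare (avg variance dirichlet pathSrc pathTgt)
open B4Block227 (poincare_path8 sq_sub_le_Ico sum_range_id_real)

/-! ## §1  The mean-zero path Poincaré inequality (`s²∕8`), `ℕ`-indexed -/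

/-- The Dirichlet form of the path on `Fin (m+1)` for `f i := w i` is the `ℕ`-indexed sum of squared forward
differences `Σ_{k<m} (w(k+1) − w k)²`. [folklore] -/
theorem dirichlet_path_eq_sum_range (m : ℕ) (w : ℕ → ℝ) :
    dirichlet (pathSrc m) (pathTgt m) (fun i : Fin (m + 1) => w i) = ∑ k ∈ range m, (w (k + 1) - w k) ^ 2 := by
  unfold dirichlet
  rw [← Fin.sum_univ_eq_sum_range (fun k => (w (k + 1) - w k) ^ 2) m]
  refine Finset.sum_congr rfl fun k _ => ?_
  simp [pathSrc, pathTgt]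

/-- The variance of `f i := w i` on `Fin (m+1)` is `Σ_{i≤m} (w i)²` when `Σ_{i≤m} w i = 0`. [folklore] -/
theorem variance_eq_sum_range_of_sum_eq_zero (m : ℕ) (w : ℕ → ℝ) (hw : ∑ i ∈ range (m + 1), w i = 0) :
    variance (fun i : Fin (m + 1) => w i) = ∑ i ∈ range (m + 1), w i ^ 2 := by
  unfold variance
  have havg : avg univ (fun i : Fin (m + 1) => w i) = 0 := by
    unfold avg
    rw [Fin.sum_univ_eq_sum_range (fun i => w i) (m + 1), hw, zero_div]
  simp only [havg, sub_zero]
  exact Fin.sum_univ_eq_sum_range (fun i => w i ^ 2) (m + 1)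

/-- **Mean-zero path Poincaré, `ℕ`-indexed** (`B4Block227.poincare_path8` BY NAME): if `Σ_{i≤m} w i = 0` then
`Σ_{i≤m} (w i)² ≤ ((m+1)²∕8)·Σ_{i<m} (w(i+1) − w i)²`. [folklore] -/
theorem sum_sq_le_of_sum_eq_zero_nat (m : ℕ) (w : ℕ → ℝ) (hw : ∑ i ∈ range (m + 1), w i = 0) :
    ∑ i ∈ range (m + 1), w i ^ 2 ≤ ((m : ℝ) + 1) ^ 2 / 8 * ∑ i ∈ range m, (w (i + 1) - w i) ^ 2 := by
  have h := poincare_path8 m (fun i : Fin (m + 1) => w i)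
  rwa [variance_eq_sum_range_of_sum_eq_zero m w hw, dirichlet_path_eq_sum_range] at h

/-! ## §2  Doubly pinned sequences: first and zeroth order by the second differences -/

/-- The forward differences of a sequence pinned at `0` and `n` sum to zero. [folklore] -/
theorem sum_fd_eq_zero_of_pinned (n : ℕ) (v : ℕ → ℝ) (h0 : v 0 = 0) (hn : v n = 0) :
    ∑ i ∈ range n, (v (i + 1) - v i) = 0 := by
  rw [Finset.sum_range_sub, h0, hn, sub_zero]

/-- ★ **Pinned first-order inequality**: `v 0 = v n = 0 ⇒ Σ_{i<n} (v(i+1) − v i)² ≤ (n²∕8)·Σ_{i<n−1} (v(i+2) − 2v(i+1) + v i)²`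
(§1 applied to the forward differences, which have zero sum). [folklore] -/
theorem sum_fd_sq_le_of_pinned (n : ℕ) (v : ℕ → ℝ) (h0 : v 0 = 0) (hn : v n = 0) :
    ∑ i ∈ range n, (v (i + 1) - v i) ^ 2
      ≤ (n : ℝ) ^ 2 / 8 * ∑ i ∈ range (n - 1), (v (i + 2) - 2 * v (i + 1) + v i) ^ 2 := by
  rcases Nat.eq_zero_or_pos n with rfl | hpos
  · simp
  · obtain ⟨m, rfl⟩ : ∃ m, n = m + 1 := ⟨n - 1, by omega⟩
    have hw : ∑ i ∈ range (m + 1), (v (i + 1) - v i) = 0 := sum_fd_eq_zero_of_pinned (m + 1) v h0 hn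
    have h := sum_sq_le_of_sum_eq_zero_nat m (fun i => v (i + 1) - v i) hw
    have hm : ((m : ℝ) + 1) = ((m + 1 : ℕ) : ℝ) := by push_cast; ring
    rw [hm] at h
    simp only [Nat.add_sub_cancel]
    refine h.trans (le_of_eq ?_)
    congr 1
    refine Finset.sum_congr rfl fun i _ => ?_
    ring

/-- **One-end pinned Poincaré, `ℕ`-indexed** (`B4Block227.sq_sub_le_Ico` summed, `Σ_{k≤n} k = n(n+1)∕2` by
`sum_range_id_real`): `v 0 = 0 ⇒ Σ_{k≤n} (v k)² ≤ (n(n+1)∕2)·Σ_{i<n} (v(i+1) − v i)²`. [folklore] -/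
theorem sum_sq_le_of_pinned_left (n : ℕ) (v : ℕ → ℝ) (h0 : v 0 = 0) :
    ∑ k ∈ range (n + 1), v k ^ 2 ≤ (n : ℝ) * (n + 1) / 2 * ∑ i ∈ range n, (v (i + 1) - v i) ^ 2 := by
  set S := ∑ i ∈ range n, (v (i + 1) - v i) ^ 2 with hS
  have hS0 : 0 ≤ S := Finset.sum_nonneg fun _ _ => sq_nonneg _
  have hk : ∀ k ∈ range (n + 1), v k ^ 2 ≤ (k : ℝ) * S := by
    intro k hk
    have hkn : k ≤ n := Nat.lt_succ_iff.mp (Finset.mem_range.mp hk)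
    have h1 := sq_sub_le_Ico v (Nat.zero_le k)
    rw [h0, sub_zero, Nat.sub_zero, ← Finset.range_eq_Ico] at h1
    refine h1.trans (mul_le_mul_of_nonneg_left ?_ (Nat.cast_nonneg _))
    exact Finset.sum_le_sum_of_subset_of_nonneg (Finset.range_mono hkn) fun _ _ _ => sq_nonneg _
  calc ∑ k ∈ range (n + 1), v k ^ 2 ≤ ∑ k ∈ range (n + 1), (k : ℝ) * S := Finset.sum_le_sum hk
    _ = (∑ k ∈ range (n + 1), (k : ℝ)) * S := by rw [Finset.sum_mul]
    _ = (n : ℝ) * (n + 1) / 2 * S := by rw [sum_range_id_real]; push_cast; ring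

/-- ★★ **THE PINNED PLATE INEQUALITY on a segment**: `v 0 = v n = 0 ⇒
Σ_{k≤n} (v k)² ≤ (n³(n+1)∕16)·Σ_{i<n−1} (v(i+2) − 2v(i+1) + v i)²` (one-end Poincaré, then §2's first-order
inequality; the plate scaling `ℓ⁴`). [folklore] -/
theorem sum_sq_le_sum_sdd_sq_of_pinned (n : ℕ) (v : ℕ → ℝ) (h0 : v 0 = 0) (hn : v n = 0) :
    ∑ k ∈ range (n + 1), v k ^ 2
      ≤ (n : ℝ) ^ 3 * (n + 1) / 16 * ∑ i ∈ range (n - 1), (v (i + 2) - 2 * v (i + 1) + v i) ^ 2 := by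
  have h1 := sum_sq_le_of_pinned_left n v h0
  have h2 := sum_fd_sq_le_of_pinned n v h0 hn
  have hc : 0 ≤ (n : ℝ) * (n + 1) / 2 := by positivity
  refine h1.trans ((mul_le_mul_of_nonneg_left h2 hc).trans (le_of_eq ?_))
  ring

/-- Pointwise edition: `v 0 = v n = 0 ⇒ (v k)² ≤ (n³∕8)·Σ_{i<n−1} (v(i+2) − 2v(i+1) + v i)²` for every `k ≤ n`
(`sq_sub_le_Ico` once, then §2). [folklore] -/
theorem sq_le_sum_sdd_sq_of_pinned (n : ℕ) (v : ℕ → ℝ) (h0 : v 0 = 0) (hn : v n = 0) {k : ℕ} (hk : k ≤ n) :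
    v k ^ 2 ≤ (n : ℝ) ^ 3 / 8 * ∑ i ∈ range (n - 1), (v (i + 2) - 2 * v (i + 1) + v i) ^ 2 := by
  have h1 := sq_sub_le_Ico v (Nat.zero_le k)
  rw [h0, sub_zero, Nat.sub_zero, ← Finset.range_eq_Ico] at h1
  have hsub : ∑ i ∈ range k, (v (i + 1) - v i) ^ 2 ≤ ∑ i ∈ range n, (v (i + 1) - v i) ^ 2 :=
    Finset.sum_le_sum_of_subset_of_nonneg (Finset.range_mono hk) fun _ _ _ => sq_nonneg _
  have h2 := sum_fd_sq_le_of_pinned n v h0 hn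
  have hkn : (k : ℝ) ≤ n := by exact_mod_cast hk
  have hS : 0 ≤ ∑ i ∈ range (n - 1), (v (i + 2) - 2 * v (i + 1) + v i) ^ 2 := Finset.sum_nonneg fun _ _ => sq_nonneg _
  calc v k ^ 2 ≤ (k : ℝ) * ∑ i ∈ range k, (v (i + 1) - v i) ^ 2 := h1
    _ ≤ (n : ℝ) * ∑ i ∈ range n, (v (i + 1) - v i) ^ 2 :=
        mul_le_mul hkn hsub (Finset.sum_nonneg fun _ _ => sq_nonneg _) (Nat.cast_nonneg _)
    _ ≤ (n : ℝ) * ((n : ℝ) ^ 2 / 8 * ∑ i ∈ range (n - 1), (v (i + 2) - 2 * v (i + 1) + v i) ^ 2) :=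
        mul_le_mul_of_nonneg_left h2 (Nat.cast_nonneg _)
    _ = (n : ℝ) ^ 3 / 8 * ∑ i ∈ range (n - 1), (v (i + 2) - 2 * v (i + 1) + v i) ^ 2 := by ring

/-! ## §3  Translated editions: a segment `[a, a + n]` of a longer line pinned at both ends -/

/-- `Σ_{i ∈ [a, a+m)} F i = Σ_{i<m} F (a + i)`. [folklore] -/
theorem sum_Ico_add_eq_sum_range {M : Type*} [AddCommMonoid M] (F : ℕ → M) (a m : ℕ) :
    ∑ i ∈ Finset.Ico a (a + m), F i = ∑ i ∈ range m, F (a + i) := by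
  rw [Finset.sum_Ico_eq_sum_range, Nat.add_sub_cancel_left]

/-- ★ Translated first-order edition: `v a = v (a+n) = 0 ⇒
Σ_{i∈[a,a+n)} (v(i+1) − v i)² ≤ (n²∕8)·Σ_{i∈[a,a+n−1)} (v(i+2) − 2v(i+1) + v i)²`. [folklore] -/
theorem sum_fd_sq_Ico_le_of_pinned (a n : ℕ) (v : ℕ → ℝ) (ha : v a = 0) (han : v (a + n) = 0) :
    ∑ i ∈ Finset.Ico a (a + n), (v (i + 1) - v i) ^ 2
      ≤ (n : ℝ) ^ 2 / 8 * ∑ i ∈ Finset.Ico a (a + (n - 1)), (v (i + 2) - 2 * v (i + 1) + v i) ^ 2 := by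
  rw [sum_Ico_add_eq_sum_range, sum_Ico_add_eq_sum_range]
  have h := sum_fd_sq_le_of_pinned n (fun i => v (a + i)) (by simpa using ha) (by simpa using han)
  simp only [add_assoc] at h ⊢
  convert h using 3

/-- ★★ **THE PINNED PLATE INEQUALITY on a segment of a line**: `v a = v (a+n) = 0 ⇒
Σ_{k∈[a,a+n]} (v k)² ≤ (n³(n+1)∕16)·Σ_{i∈[a,a+n−1)} (v(i+2) − 2v(i+1) + v i)²` — for a tile line between two pinned
centres `c = a`, `c + ℓe_κ = a + n` this is `Σ μ² ≤ (ℓ³(ℓ+1)∕16)·Σ (∂_κ∂_κ μ)²` with the second differences supported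
strictly inside the segment. [folklore] -/
theorem sum_sq_Ico_le_of_pinned (a n : ℕ) (v : ℕ → ℝ) (ha : v a = 0) (han : v (a + n) = 0) :
    ∑ k ∈ Finset.Ico a (a + (n + 1)), v k ^ 2
      ≤ (n : ℝ) ^ 3 * (n + 1) / 16 * ∑ i ∈ Finset.Ico a (a + (n - 1)), (v (i + 2) - 2 * v (i + 1) + v i) ^ 2 := by
  rw [sum_Ico_add_eq_sum_range, sum_Ico_add_eq_sum_range]
  have h := sum_sq_le_sum_sdd_sq_of_pinned n (fun i => v (a + i)) (by simpa using ha) (by simpa using han)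
  simp only [add_assoc] at h ⊢
  convert h using 3

/-- Scale reading of the constant: `n³(n+1)∕16 ≤ n⁴∕8` for `1 ≤ n` (the plate scaling `ℓ⁴`). [folklore] -/
theorem pinned_plate_const_le (n : ℕ) (hn : 1 ≤ n) : (n : ℝ) ^ 3 * (n + 1) / 16 ≤ (n : ℝ) ^ 4 / 8 := by
  have h1 : (1 : ℝ) ≤ n := by exact_mod_cast hn
  nlinarith [pow_nonneg (Nat.cast_nonneg n : (0 : ℝ) ≤ n) 3]

end Summit.QuantumFields.YangMills.Theorems.N07PinnedLineInequalities

end
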